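import Summits.BirchSwinnertonDyer.Rank1Residual.X4.KuriharaLevelLoweringModPow
import Summits.BirchSwinnertonDyer.Rank1Residual.X4.KimDefectLevelLowering
import HarnessLib

/-!
# TAM-DEFECT rows with `ord_p ∏ c ≤ e + 1` CLOSE from a mod-`p^e` level-lowering certificate: `∂^{(∞)}(δ̃) ≥ e` (file `X4/KuriharaLevelLoweringModPow.lean`) fed into the ONE-FACTOR socket, Kim (6) and the parity law — analytic rank `0` (cell `b2b-bsdres`, seat additive-p4 gen 29, line V49; CLASS-CLOSURE §3.1 N11 / §3.2 N10, the `ord_p ∏ c ≥ 3` rows)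

HONEST FRAMING (cell `b2b-bsdres`, verbatim in every file): the goal of the cell is to DELETE the
COMBINATION-SHAPED residual classes for ALL analytic-rank `≤ 1` curves over `ℚ` — "full BSD formula for
every rank `≤ 1` curve in class `C`" assembled STRICTLY from published theorems — so that the rank-`≤ 1`
remainder becomes exactly the CONSTRUCTION-SHAPED classes, which are TYPED (missing-input Props), NOT
attempted; this is not "finishing BSD". This file: research route on the CONSTRUCTION-shaped class X4
(additive `p`, `E[p]` irreducible); X4 stays CONSTRUCTION-SHAPED; labels unchanged; nothing booked; no
Literature fact minted; every `p = 3` statement is CONDITIONAL on the announced Kim 2025 clause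
(`Kim2025.thm11_kimShaLength_of_integralPeriod_OPEN`, flag `Kim2025-preprint`); THEOREMS ONLY; `#print
axioms` standard.

## What is here

Gen 20 (`X4/KimDefectLevelLowering.lean`) closed, per pair and from ONE finite mod-`p` certificate
`PlusSymbolLevelLowersAt W p D.f ℓ` (`∂^{(∞)} ≥ 1`), the unit rows with `ord_p ∏_v c_v ≤ 2` (rank `0`). The sibling `X4/KuriharaLevelLoweringModPow.lean` proves the EXPONENT form: the
mod-`p^e` certificate `PlusSymbolLevelLowersModAt W p D.f (p^e) ℓ` gives **`∂^{(∞)}(δ̃) ≥ e`**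
(`le_kuriharaPartialInfty_of_plusSymbolLevelLowersModAt`). This file draws the consequences, with
`α = e` in the cell's sockets:

* §1 (`p ≥ 5`, PUBLISHED inputs — Kim 2026 Thm. 1.8 (6) `hKimk`/`hE67c`/`hKim6`, Cassels–Tate `hCT`,
  GZK, modularity — plus the certificate): `ord_p ∏ c ≤ e` ⟹ the `≥` half of Conjecture 1.10 and
  the UPPER half WITHOUT Cassels–Tate; **`ord_p ∏ c ≤ e + 1`, `#Ш_an` a `p`-unit ⟹ `BSD(E,p)`**
  (+ the OPTIMAL-datum form).
* §2 (`p ≥ 3` unit TOWER rows, CONDITIONAL on the preprint clause `hK25s`): the same closure — at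
  `p = 3` this is the N11 TAM-DEFECT(3) block with `ord₃ ∏ c = e + 1 ≥ 3`.
* §3 (exactness): on the certified unit rows with `ord_p ∏ c ≤ e + 1`, Kim's Conjecture 1.10 holds AT
  THE PAIR (`∂^{(∞)} = ord_p ∏ c`; `p ≥ 5` published, `p ≥ 3` modulo the preprint) — the E1 reading
  "every cyclic `δ̃_n^{(k)}` is divisible by `p^{min(e+1,k)}` and one has valuation exactly `e + 1`".
The rank-one companion is `X4/KimDefectLevelLoweringModPowRankOne.lean`.

WHERE IT BITES (E2 anatomy; numbers of record, nothing booked): the `ord_p ∏ c ≥ 3` rows of the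
TAM-DEFECT residue — 4 sweep rows at `p ≥ 5` (N10) and 235 at `p = 3` (N11), seat census V47-B —
whose defect beyond one unit is carried by ONE prime `ℓ` with `ord_p c_ℓ = e ≥ 2`: per pair, from a
FINITE mod-`p^e` certificate (two modular-symbol lattices mod `p^e`; instrument E4/E5 at modulus
`p^e`, gen 27 batch X: `e_max = ord_p c_ℓ` on 4/4). Rows whose defect is spread over several primes
each with `ord_p c = 1` are NOT reached by a single-prime certificate (the product structure
`(1 − σ_{ℓ₁}^{-1})(1 − σ_{ℓ₂}^{-1})` is depth in the augmentation filtration, not `p`-divisibility).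
The certificate is EVIDENCE computed per row, never a fact (Dahmen–Yazdani 2012 Thm. 2, the printed
mod-`l^r` level lowering, assumes `l² ∤ N` — unavailable on X4).

References: Kim 2026 [Kim2022StructureSelmer] Thm. 1.9 (6), §1.5.1, Conj. 1.10; Kim 2025
[Kim2025RefinedTNC] Thm. 1.1 (PREPRINT, reason only); Silverman AEC X.4.14 [SilvermanAEC2009]; Miller
2011 [Miller2011LMS] Def. 1.1; Cremona 1997 [CremonaAlgorithms1997] §2.8; Dahmen–Yazdani 2012
[DahmenYazdani2012] Thm. 2 (why the certificate is expected; not an input).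
-/

noncomputable section

open scoped Classical MatrixGroups ModularForm

open CongruenceSubgroup WeierstrassCurve Literature.NumberTheory.EllipticCurves
  Literature.NumberTheory.EllipticCurves.ModularForms
  Literature.NumberTheory.EllipticCurves.Rank1Residual
  Literature.NumberTheory.EllipticCurves.Rank1Residual.Typed
  Summit.BirchSwinnertonDyer.Rank1Residual.LevelLowering
  Summit.BirchSwinnertonDyer.Rank1Residual.Additive

namespace Summit.BirchSwinnertonDyer.Rank1Residual.X4

variable (W : WeierstrassCurve ℚ) [W.IsElliptic] [W.IsGloballyMinimal] (p : ℕ) [Fact p.Prime]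

/-! ### §1 `p ≥ 5`, analytic rank `0`: published inputs + the mod-`p^e` certificate -/

section RankZeroFiveLe

/-- **The `≥` half of Kim's Conjecture 1.10 on a row with `ord_p ∏_v c_v ≤ e`, from a mod-`p^e`
certificate**: `p` odd, `E[p]` irreducible, conductor-level datum `D`,
`PlusSymbolLevelLowersModAt W p D.f (p^e) ℓ` at some `ℓ ∣ N_E` ⟹ `KimTamagawaDefectGeAt W p D.f`
(`ord_p ∏ c ≤ e ≤ ∂^{(∞)}`). No Cassels–Tate, no Kim fact: bookkeeping over the sibling's
`le_kuriharaPartialInfty_of_plusSymbolLevelLowersModAt`. [cite: Kim2022StructureSelmer, Conj. 1.10 (PDF p. 8)] -/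
theorem kimTamagawaDefectGeAt_of_plusSymbolLevelLowersModAt_of_tamagawa_le
    (hp2 : p ≠ 2) (hirr : W.HasIrreducibleModPGaloisRep p)
    {N : ℕ} [NeZero N] (D : ModularParametrizationData W N) (hN : W.conductorNorm ℤ = N)
    {e ℓ : ℕ} (hcert : PlusSymbolLevelLowersModAt W p D.f (p ^ e) ℓ) (hℓ : ℓ ∣ W.conductorNorm ℤ)
    (hce : padicValNat p W.tamagawaProduct ≤ e) : KimTamagawaDefectGeAt W p D.f := by
  unfold KimTamagawaDefectGeAt
  calc (padicValNat p W.tamagawaProduct : ℕ∞) ≤ ((e : ℕ) : ℕ∞) := by exact_mod_cast hce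
    _ ≤ kuriharaPartialInfty W p D.f :=
      le_kuriharaPartialInfty_of_plusSymbolLevelLowersModAt hp2 hirr D hN hcert hℓ

/-- **UPPER half on the rows with `ord_p ∏_v c_v ≤ e` WITHOUT Cassels–Tate**: `p ≥ 5`, analytic rank
`0`, `ρ̄_{E,p}` onto, conductor-level datum with `p ∤ c_D` and the period transfer, and a mod-`p^e`
certificate ⟹ `MissingUpperBoundAt W p`. Inputs: Kim Thm. 1.8 (6) ∀-form (`hKim6`), GZK, modularity
(via `missingUpperBoundAt_of_kimTamagawaDefectGe`). [cite: Kim2022StructureSelmer, Thm. 1.9 (6) and Conj. 1.10 (PDF p. 8)]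
[cite: Miller2011LMS, Def. 1.1] -/
theorem missingUpperBoundAt_of_plusSymbolLevelLowersModAt_of_tamagawa_le_of_five_le
    (hKim6 : Kim2026.rankZero_padicValNat_sha_add_le_of_forall_pow_dvd_kuriharaNumber_cyclicLevel)
    (hGZK : rank_eq_analyticRank_of_analyticRank_le_one) (hmod : hasEntireLFunction_rat)
    (hp : 5 ≤ p) (hr : W.analyticRank = 0) (hsurj : W.HasSurjectiveModNGaloisRep p)
    {N : ℕ} [NeZero N] (D : ModularParametrizationData W N) (hN : W.conductorNorm ℤ = N)
    (hc : ¬ (p : ℤ) ∣ D.maninConstant)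
    (hper : ∃ u : ℚ, ‖(u : ℚ_[p])‖ = 1 ∧ W.realPeriodRat = u * plusPeriod D.f)
    {e ℓ : ℕ} (hcert : PlusSymbolLevelLowersModAt W p D.f (p ^ e) ℓ) (hℓ : ℓ ∣ W.conductorNorm ℤ)
    (hce : padicValNat p W.tamagawaProduct ≤ e) : MissingUpperBoundAt W p :=
  missingUpperBoundAt_of_kimTamagawaDefectGe W p hKim6 hGZK hmod hp hr hsurj D hN hc hper
    (kimTamagawaDefectGeAt_of_plusSymbolLevelLowersModAt_of_tamagawa_le W p (by omega)
      (hasIrreducibleModPGaloisRep_of_hasSurjectiveModNGaloisRep W p hsurj) D hN hcert hℓ hce)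

/-- **THE `ord_p ∏ c ≤ e + 1` CLOSURE at `p ≥ 5`**: analytic rank `0`, `ρ̄_{E,p}` onto, conductor-level
datum `D` with `p ∤ c_D` and the period transfer, `#Ш_an = q'` a `p`-adic unit,
**`ord_p ∏_v c_v ≤ e + 1`**, and a mod-`p^e` LEVEL-LOWERING CERTIFICATE for the plus symbol of `D.f` at
some `ℓ ∣ N_E`: **`BSD(E,p)` holds.** Inputs: Kim 2026 Thm. 1.8 (6) (`hKimk`, `hE67c`), Cassels–Tate
(`hCT`), GZK, modularity — PUBLISHED — and the certificate (per-pair EVIDENCE, NOT a fact); the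
one-factor socket `bsdp_of_le_kimDefect_of_tamagawa_le_add_one_of_shaAn_unit` with `α = e`. At `e = 1`
this is gen 20's `ord_p ∏ c ≤ 2` closure; at `e ≥ 2` it reaches the `ord_p ∏ c ≥ 3` rows of N10.
Nothing booked; X4 CONSTRUCTION-SHAPED. [cite: Kim2022StructureSelmer, Thm. 1.9 (6) and Conj. 1.10 (PDF p. 8)]
[cite: SilvermanAEC2009, Thm. X.4.14] [cite: Miller2011LMS, §1 and Def. 1.1] -/
theorem bsdp_of_plusSymbolLevelLowersModAt_of_tamagawa_le_succ_of_shaAn_unit_of_five_le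
    (hKimk : Kim2026.rankZero_le_padicValNat_sha_of_kuriharaNumber_ne_zero)
    (hE67c : Kim2026.rankZero_padicValNat_sha_add_le_of_forall_pow_dvd_kuriharaNumber_cyclicLevel)
    (hCT : exists_casselsTate_pairing (K := ℚ))
    (hGZK : rank_eq_analyticRank_of_analyticRank_le_one) (hmod : hasEntireLFunction_rat)
    (hp : 5 ≤ p) (hr : W.analyticRank = 0) (hsurj : W.HasSurjectiveModNGaloisRep p)
    {N : ℕ} [NeZero N] (D : ModularParametrizationData W N) (hN : W.conductorNorm ℤ = N)
    (hc : ¬ (p : ℤ) ∣ D.maninConstant)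
    (hper : ∃ u : ℚ, ‖(u : ℚ_[p])‖ = 1 ∧ W.realPeriodRat = u * plusPeriod D.f)
    {q' : ℚ} (hq' : shaAn W = (q' : ℂ)) (hv : padicValRat p q' = 0)
    {e ℓ : ℕ} (hcert : PlusSymbolLevelLowersModAt W p D.f (p ^ e) ℓ) (hℓ : ℓ ∣ W.conductorNorm ℤ)
    (hce : padicValNat p W.tamagawaProduct ≤ e + 1) : BSDp W p := by
  have hirr := hasIrreducibleModPGaloisRep_of_hasSurjectiveModNGaloisRep W p hsurj
  have he : (e : ℕ∞) ≤ kuriharaPartialInfty W p D.f :=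
    le_kuriharaPartialInfty_of_plusSymbolLevelLowersModAt (by omega) hirr D hN hcert hℓ
  exact bsdp_of_le_kimDefect_of_tamagawa_le_add_one_of_shaAn_unit W p hKimk hE67c hCT hGZK hmod hp hr
    hsurj D hN hc hper hq' hv he hce

/-- **The `ord_p ∏ c ≤ e + 1` closure at `p ≥ 5` on an OPTIMAL conductor-level datum** (period
transfer by optimality, `X4.periodTransfer_of_optimal`): the census shape — Cremona optimality, one
class integer `c` with `p ∤ c`, `surj(p)`, `#Ш_an` unit, `ord_p ∏ c ≤ e + 1`, and the mod-`p^e`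
certificate. [cite: Kim2022StructureSelmer, Thm. 1.9 (6) and Conj. 1.10 (PDF p. 8)] [cite: SilvermanAEC2009, Thm. X.4.14]
[cite: Miller2011LMS, §1 and Def. 1.1] [cite: CremonaAlgorithms1997, §2.8 (p. 26)] -/
theorem bsdp_of_plusSymbolLevelLowersModAt_of_tamagawa_le_succ_of_shaAn_unit_of_optimal_of_five_le
    (hKimk : Kim2026.rankZero_le_padicValNat_sha_of_kuriharaNumber_ne_zero)
    (hE67c : Kim2026.rankZero_padicValNat_sha_add_le_of_forall_pow_dvd_kuriharaNumber_cyclicLevel)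
    (hCT : exists_casselsTate_pairing (K := ℚ))
    (hGZK : rank_eq_analyticRank_of_analyticRank_le_one) (hmod : hasEntireLFunction_rat)
    (hp : 5 ≤ p) (hr : W.analyticRank = 0) (hsurj : W.HasSurjectiveModNGaloisRep p)
    {N : ℕ} [NeZero N] (D : ModularParametrizationData W N) (hN : W.conductorNorm ℤ = N)
    (hopt : ∀ z ∈ D.L.lattice, ∃ w ∈ periodLattice D.f, z = D.c * w)
    (hc : ¬ (p : ℤ) ∣ D.maninConstant)
    {q' : ℚ} (hq' : shaAn W = (q' : ℂ)) (hv : padicValRat p q' = 0)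
    {e ℓ : ℕ} (hcert : PlusSymbolLevelLowersModAt W p D.f (p ^ e) ℓ) (hℓ : ℓ ∣ W.conductorNorm ℤ)
    (hce : padicValNat p W.tamagawaProduct ≤ e + 1) : BSDp W p :=
  bsdp_of_plusSymbolLevelLowersModAt_of_tamagawa_le_succ_of_shaAn_unit_of_five_le W p hKimk hE67c hCT
    hGZK hmod hp hr hsurj D hN hc (periodTransfer_of_optimal p D hopt hc) hq' hv hcert hℓ hce

end RankZeroFiveLe

/-! ### §2 `p ≥ 3` unit TOWER rows (N11 at `p = 3`), CONDITIONAL on the announced Kim 2025 clause -/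

section RankZeroTower

/-- **THE `ord_p ∏ c ≤ e + 1` CLOSURE at `p ≥ 3` on a unit TOWER row, CONDITIONAL on the preprint**
(`hK25s`, flag `Kim2025-preprint`): analytic rank `0`, `ρ̄_{E,p^n}` onto for all `n`, conductor-level
datum `D` with the period transfer, `#Ш_an = q'` a `p`-unit, `ord_p ∏_v c_v ≤ e + 1`, and a mod-`p^e`
level-lowering certificate at some `ℓ ∣ N_E` ⟹ `BSD(E,p)`. At `p = 3` and `e ≥ 2` this is the N11
TAM-DEFECT(3) block with `ord₃ ∏ c ≥ 3` carried by one prime (235 sweep rows, V47-B), per pair, on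
one finite certificate. [claim: Kim2025RefinedTNC, status: under-review]
[cite: Kim2025RefinedTNC, Thm. 1.1 ("BSD") (ANNOUNCED, OPEN binder)] [cite: SilvermanAEC2009, Thm. X.4.14]
[cite: Kim2022StructureSelmer, Conj. 1.10 (PDF p. 8)] [cite: Miller2011LMS, §1 and Def. 1.1] -/
theorem bsdp_of_plusSymbolLevelLowersModAt_of_tamagawa_le_succ_of_shaAn_unit_of_kim2025_OPEN
    (hK25s : Kim2025.thm11_kimShaLength_of_integralPeriod_OPEN)
    (hCT : exists_casselsTate_pairing (K := ℚ))
    (hGZK : rank_eq_analyticRank_of_analyticRank_le_one) (hmod : hasEntireLFunction_rat)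
    (hp3 : 3 ≤ p) (hr : W.analyticRank = 0) (htower : ∀ n : ℕ, W.HasSurjectiveModNGaloisRep (p ^ n : ℕ))
    {N : ℕ} [NeZero N] (D : ModularParametrizationData W N) (hN : W.conductorNorm ℤ = N)
    (hper : ∃ u : ℚ, ‖(u : ℚ_[p])‖ = 1 ∧ W.realPeriodRat = u * plusPeriod D.f)
    {q' : ℚ} (hq' : shaAn W = (q' : ℂ)) (hv : padicValRat p q' = 0)
    {e ℓ : ℕ} (hcert : PlusSymbolLevelLowersModAt W p D.f (p ^ e) ℓ) (hℓ : ℓ ∣ W.conductorNorm ℤ)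
    (hce : padicValNat p W.tamagawaProduct ≤ e + 1) : BSDp W p := by
  have hsurj : W.HasSurjectiveModNGaloisRep p := by simpa using htower 1
  have hirr := hasIrreducibleModPGaloisRep_of_hasSurjectiveModNGaloisRep W p hsurj
  have he : (e : ℕ∞) ≤ kuriharaPartialInfty W p D.f :=
    le_kuriharaPartialInfty_of_plusSymbolLevelLowersModAt (by omega) hirr D hN hcert hℓ
  exact Additive.bsdp_of_le_kimDefect_of_tamagawa_le_add_one_of_shaAn_unit_of_kim2025_OPEN W p hK25s
    hCT hGZK hmod hp3 hr htower D hper hq' hv he hce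

/-- **The `p ≥ 3` closure on an OPTIMAL conductor-level datum with `p ∤ c`, CONDITIONAL on the
preprint** — the census shape for Cremona's optimal curves at `3` (tower bit from a `j`-witness /
I₀* / surj(9) certificate upstream; `3 ∤ c` from the Manin table; the mod-`3^e` certificate from the
seat's instrument). [claim: Kim2025RefinedTNC, status: under-review]
[cite: Kim2025RefinedTNC, Thm. 1.1 ("BSD") (ANNOUNCED, OPEN binder)] [cite: SilvermanAEC2009, Thm. X.4.14]
[cite: CremonaAlgorithms1997, §2.8 (p. 26)] -/
theorem bsdp_of_plusSymbolLevelLowersModAt_of_tamagawa_le_succ_of_shaAn_unit_of_optimal_of_kim2025_OPEN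
    (hK25s : Kim2025.thm11_kimShaLength_of_integralPeriod_OPEN)
    (hCT : exists_casselsTate_pairing (K := ℚ))
    (hGZK : rank_eq_analyticRank_of_analyticRank_le_one) (hmod : hasEntireLFunction_rat)
    (hp3 : 3 ≤ p) (hr : W.analyticRank = 0) (htower : ∀ n : ℕ, W.HasSurjectiveModNGaloisRep (p ^ n : ℕ))
    {N : ℕ} [NeZero N] (D : ModularParametrizationData W N) (hN : W.conductorNorm ℤ = N)
    (hopt : ∀ z ∈ D.L.lattice, ∃ w ∈ periodLattice D.f, z = D.c * w)
    (hc : ¬ (p : ℤ) ∣ D.maninConstant)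
    {q' : ℚ} (hq' : shaAn W = (q' : ℂ)) (hv : padicValRat p q' = 0)
    {e ℓ : ℕ} (hcert : PlusSymbolLevelLowersModAt W p D.f (p ^ e) ℓ) (hℓ : ℓ ∣ W.conductorNorm ℤ)
    (hce : padicValNat p W.tamagawaProduct ≤ e + 1) : BSDp W p :=
  bsdp_of_plusSymbolLevelLowersModAt_of_tamagawa_le_succ_of_shaAn_unit_of_kim2025_OPEN W p hK25s hCT
    hGZK hmod hp3 hr htower D hN (periodTransfer_of_optimal p D hopt hc) hq' hv hcert hℓ hce

end RankZeroTower

/-! ### §3 Conjecture 1.10 EXACTLY on the certified rows: `∂^{(∞)}(δ̃) = ord_p ∏ c = e + 1` -/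

section Exact

/-- **On a certified unit row with `ord_p ∏_v c_v ≤ e + 1` (`p ≥ 5`), Kim's Conjecture 1.10 HOLDS at the
pair**: `KimTamagawaDefectAt W p D.f`, i.e. `∂^{(∞)}(δ̃_{D.f}) = ord_p ∏_v c_v` EXACTLY — from §1's
`BSD(E,p)` and gen 17's iff `bsdp_iff_kimTamagawaDefectAt_of_kimFacts_of_five_le` (PUBLISHED inputs).
E1 reading for the Kurihara lanes: on such a row EVERY cyclic-level `δ̃_n^{(k)}` is divisible by
`p^{min(ord_p ∏c, k)}` AND some cyclic level carries a Kurihara number of valuation exactly `ord_p ∏c`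
— a pre-registrable prediction at the levels `k ≥ e + 1`.
[cite: Kim2022StructureSelmer, Thm. 1.9 (6) and Conj. 1.10 (PDF p. 8)] [cite: SilvermanAEC2009, Thm. X.4.14]
[cite: Miller2011LMS, §1 and Def. 1.1] -/
theorem kimTamagawaDefectAt_of_plusSymbolLevelLowersModAt_of_tamagawa_le_succ_of_shaAn_unit_of_five_le
    (hKimk : Kim2026.rankZero_le_padicValNat_sha_of_kuriharaNumber_ne_zero)
    (hE67c : Kim2026.rankZero_padicValNat_sha_add_le_of_forall_pow_dvd_kuriharaNumber_cyclicLevel)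
    (hCT : exists_casselsTate_pairing (K := ℚ))
    (hGZK : rank_eq_analyticRank_of_analyticRank_le_one) (hmod : hasEntireLFunction_rat)
    (hp : 5 ≤ p) (hr : W.analyticRank = 0) (hsurj : W.HasSurjectiveModNGaloisRep p)
    {N : ℕ} [NeZero N] (D : ModularParametrizationData W N) (hN : W.conductorNorm ℤ = N)
    (hc : ¬ (p : ℤ) ∣ D.maninConstant)
    (hper : ∃ u : ℚ, ‖(u : ℚ_[p])‖ = 1 ∧ W.realPeriodRat = u * plusPeriod D.f)
    {q' : ℚ} (hq' : shaAn W = (q' : ℂ)) (hv : padicValRat p q' = 0)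
    {e ℓ : ℕ} (hcert : PlusSymbolLevelLowersModAt W p D.f (p ^ e) ℓ) (hℓ : ℓ ∣ W.conductorNorm ℤ)
    (hce : padicValNat p W.tamagawaProduct ≤ e + 1) : KimTamagawaDefectAt W p D.f :=
  (bsdp_iff_kimTamagawaDefectAt_of_kimFacts_of_five_le W p hKimk hE67c hGZK hmod hp hr hsurj D hN hc
    hper).mp
    (bsdp_of_plusSymbolLevelLowersModAt_of_tamagawa_le_succ_of_shaAn_unit_of_five_le W p hKimk hE67c hCT
      hGZK hmod hp hr hsurj D hN hc hper hq' hv hcert hℓ hce)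

/-- **`∂^{(∞)}(δ̃) = e + 1` on a certified unit row with `ord_p ∏_v c_v = e + 1`** (`p ≥ 5`, PUBLISHED
inputs + the mod-`p^e` certificate): all cyclic Kurihara numbers vanish mod `p^{min(e+1,k)}`, and one
has valuation exactly `e + 1`. [cite: Kim2022StructureSelmer, Conj. 1.10 (PDF p. 8)] -/
theorem kuriharaPartialInfty_eq_succ_of_plusSymbolLevelLowersModAt_of_shaAn_unit_of_five_le
    (hKimk : Kim2026.rankZero_le_padicValNat_sha_of_kuriharaNumber_ne_zero)
    (hE67c : Kim2026.rankZero_padicValNat_sha_add_le_of_forall_pow_dvd_kuriharaNumber_cyclicLevel)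
    (hCT : exists_casselsTate_pairing (K := ℚ))
    (hGZK : rank_eq_analyticRank_of_analyticRank_le_one) (hmod : hasEntireLFunction_rat)
    (hp : 5 ≤ p) (hr : W.analyticRank = 0) (hsurj : W.HasSurjectiveModNGaloisRep p)
    {N : ℕ} [NeZero N] (D : ModularParametrizationData W N) (hN : W.conductorNorm ℤ = N)
    (hc : ¬ (p : ℤ) ∣ D.maninConstant)
    (hper : ∃ u : ℚ, ‖(u : ℚ_[p])‖ = 1 ∧ W.realPeriodRat = u * plusPeriod D.f)
    {q' : ℚ} (hq' : shaAn W = (q' : ℂ)) (hv : padicValRat p q' = 0)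
    {e ℓ : ℕ} (hcert : PlusSymbolLevelLowersModAt W p D.f (p ^ e) ℓ) (hℓ : ℓ ∣ W.conductorNorm ℤ)
    (hce : padicValNat p W.tamagawaProduct = e + 1) :
    kuriharaPartialInfty W p D.f = ((e + 1 : ℕ) : ℕ∞) := by
  have h := kimTamagawaDefectAt_of_plusSymbolLevelLowersModAt_of_tamagawa_le_succ_of_shaAn_unit_of_five_le
    W p hKimk hE67c hCT hGZK hmod hp hr hsurj D hN hc hper hq' hv hcert hℓ hce.le
  rw [KimTamagawaDefectAt] at h
  rw [h, hce]

/-- **The `p ≥ 3` tower twin, CONDITIONAL on the preprint**: on a certified unit tower row with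
`ord_p ∏_v c_v ≤ e + 1`, Kim's Conjecture 1.10 holds at the pair modulo `Kim2025…_OPEN` — at `p = 3` the
E1 prediction for the Kurihara lanes on the N11 `ord₃ ∏ c = e + 1 ≥ 3` rows: EVERY cyclic `δ̃_n`
vanishes mod `3^{e+1}` at the levels `n ∈ 𝒩_{e+1}`, and some cyclic level has valuation exactly `e + 1`.
[claim: Kim2025RefinedTNC, status: under-review]
[cite: Kim2025RefinedTNC, Thm. 1.1 ("BSD") (ANNOUNCED, OPEN binder)] [cite: Kim2022StructureSelmer, Conj. 1.10 (PDF p. 8)] -/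
theorem kimTamagawaDefectAt_of_plusSymbolLevelLowersModAt_of_tamagawa_le_succ_of_shaAn_unit_of_kim2025_OPEN
    (hK25s : Kim2025.thm11_kimShaLength_of_integralPeriod_OPEN)
    (hCT : exists_casselsTate_pairing (K := ℚ))
    (hGZK : rank_eq_analyticRank_of_analyticRank_le_one) (hmod : hasEntireLFunction_rat)
    (hp3 : 3 ≤ p) (hr : W.analyticRank = 0) (htower : ∀ n : ℕ, W.HasSurjectiveModNGaloisRep (p ^ n : ℕ))
    {N : ℕ} [NeZero N] (D : ModularParametrizationData W N) (hN : W.conductorNorm ℤ = N)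
    (hper : ∃ u : ℚ, ‖(u : ℚ_[p])‖ = 1 ∧ W.realPeriodRat = u * plusPeriod D.f)
    {q' : ℚ} (hq' : shaAn W = (q' : ℂ)) (hv : padicValRat p q' = 0)
    {e ℓ : ℕ} (hcert : PlusSymbolLevelLowersModAt W p D.f (p ^ e) ℓ) (hℓ : ℓ ∣ W.conductorNorm ℤ)
    (hce : padicValNat p W.tamagawaProduct ≤ e + 1) : KimTamagawaDefectAt W p D.f := by
  have hp2 : p ≠ 2 := by omega
  have hint := Additive.forall_padicValRat_ratPlusSymbol_nonneg_of_towerSurj hp2 D.isNewformOf htower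
  exact (Additive.bsdp_iff_kimTamagawaDefectAt_of_kim2025_OPEN W p hK25s hGZK hmod hp3 hr htower D hper
    hint).mp
    (bsdp_of_plusSymbolLevelLowersModAt_of_tamagawa_le_succ_of_shaAn_unit_of_kim2025_OPEN W p hK25s hCT
      hGZK hmod hp3 hr htower D hN hper hq' hv hcert hℓ hce)

end Exact

end Summit.BirchSwinnertonDyer.Rank1Residual.X4

end
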